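import Literature.NumberTheory.EllipticCurves.FullTwoTorsionConductorExponentProofs
import HarnessLib

/-!
# One rational point of order `2` forces `2 ∣ c_ℓ`, Kodaira type `III / III* / Iₙ*` and `f_ℓ = 2` at every odd additive prime

`Proofs`-style file (THEOREMS ONLY: no definition, no named fact, no instance); sequel of
`FullTwoTorsionConductorExponentProofs` (three rational points of order `2` ⇒ `c_ℓ = 4`, type `Iₙ*`). Here a
SINGLE rational point of order `2` (`HasRationalTwoTorsionX W x`, Greenberg's predicate) suffices for the conductor
statement. For `W/ℚ` globally minimal elliptic and an odd prime `ℓ` of ADDITIVE reduction: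

* `two_dvd_localTamagawaNumber_padic_of_additive_of_hasRationalTwoTorsionX` — `2 ∣ c_ℓ = [E(ℚ_ℓ) : E₀(ℚ_ℓ)]`: the
  rational point of order `2` maps to an element of order `2` of `E(ℚ_ℓ)/E₁(ℚ_ℓ)` (`E₁(ℚ_ℓ)` has no `2`-torsion for
  odd `ℓ`, *AEC* VII.3.1), a group of order `c_ℓ · #Ẽ_ns(𝔽_ℓ) = c_ℓ · ℓ` (*AEC* VII.2.1, Ex. 3.5);
* `kodairaSymbolAt_of_additive_of_hasRationalTwoTorsionX` — the Kodaira type is `III`, `III*` or `Iₙ*`: the other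
  additive types have ODD `c` (`II`, `II*`: `1`; `IV`, `IV*`: `1` or `3`; *ATAEC* IV.9.4, tree facts
  `localTamagawaNumber_…_holds`);
* `conductorExponent_eq_two_of_additive_of_hasRationalTwoTorsionX`,
  `factorization_conductorNorm_eq_two_of_additive_of_hasRationalTwoTorsionX` — `f_ℓ = ord_ℓ(N_E) = 2` (types
  `III, III*, Iₙ*` are tame at `v ∤ 2`, tree `conductorExponent_eq_two_of_kodairaSymbolAt`; equivalently: `ℚ(E[2])/ℚ`
  has degree `≤ 2`, so wild inertia at an odd prime acts trivially on `E[2]` and `δ_ℓ = 0`);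
* `factorization_conductorNorm_le_two_of_ne_two_of_hasRationalTwoTorsionX` — `ord_ℓ(N_E) ≤ 2` at EVERY odd prime.

Consumers (cell `bsd-rank2`, route `EisensteinDepletionAtTwo`): the one-point habitat (Greenberg types A/B) of the crux E1 /
E1M and of the planner's mod-`2` Eisenstein identity (★), whose depleted form uses `ord_ℓ(N) ≤ 2`.

References: J. H. Silverman, *AEC* (GTM 106, 2009) VII.2.1, VII.3.1, VII.6.1, Ex. 3.5 [SilvermanAEC2009];
J. H. Silverman, *ATAEC* (GTM 151, 1994) IV.9.4 and Table 4.1, IV.10.4, IV.11.1 [SilvermanATAEC1994].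
-/

noncomputable section

open scoped Classical

open WeierstrassCurve IsDedekindDomain NumberField Rat.HeightOneSpectrum
  Literature.NumberTheory.EllipticCurves.Greenberg1999
  Literature.NumberTheory.DiophantineGeometry

namespace Literature.NumberTheory.EllipticCurves

section OnePoint

variable (W : WeierstrassCurve ℚ) [W.IsElliptic] [W.IsGloballyMinimal] (p : ℕ) [hp : Fact p.Prime]

/-- **`2 ∣ c_ℓ` at an odd additive prime of a curve with a rational point of order `2`.** For `W/ℚ` globally
minimal elliptic with a rational point of order `2` and an odd prime `p` at which `W` is neither good nor
multiplicative: `2 ∣ [E(ℚ_p) : E₀(ℚ_p)]`. Proof: the point maps to an element of order `2` of `G = E(ℚ_p)/E₁(ℚ_p)`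
(`E₁(ℚ_p)` has no `2`-torsion for odd `p`, *AEC* VII.3.1, tree `eq_zero_of_nsmul_eq_zero_of_isInReductionKernel`),
and `#G = c_p · p` (*AEC* VII.2.1, Ex. 3.5; tree `index_formalFiltration_one_of_additive`), `p` odd.
[cite: SilvermanAEC2009, VII.2.1, VII.3.1 and Exercise 3.5] -/
theorem two_dvd_localTamagawaNumber_padic_of_additive_of_hasRationalTwoTorsionX (hp2 : p ≠ 2)
    (hng : ¬ W.HasGoodReductionAtPrime p) (hnm : ¬ W.HasMultiplicativeReductionAtPrime p)
    {x : ℚ} (hx : HasRationalTwoTorsionX W x) :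
    2 ∣ (W.baseChange ℚ_[p]).localTamagawaNumber ℤ_[p] := by
  haveI : (W.baseChange ℚ_[p]).IsMinimal ℤ_[p] := isMinimal_map_padic_of_isGloballyMinimal W p
  haveI : (W.baseChange ℚ_[p]).IsElliptic := by rw [baseChange]; infer_instance
  set F1 := (W.baseChange ℚ_[p]).formalFiltration 1 with hF1
  set c := (W.baseChange ℚ_[p]).localTamagawaNumber ℤ_[p] with hc
  haveI hfi : F1.FiniteIndex := (W.baseChange ℚ_[p]).finiteIndex_formalFiltration 1
  have hidx : F1.index = c * p := index_formalFiltration_one_of_additive W p hng hnm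
  set G := (W.baseChange ℚ_[p]).toAffine.Point ⧸ F1 with hG
  have hcardG : Nat.card G = c * p := hidx
  -- the map `E(ℚ) → E(ℚ_p) → G`
  set π : (W.baseChange ℚ_[p]).toAffine.Point →+ G := QuotientAddGroup.mk' F1 with hπ
  set φ : W.toAffine.Point →+ G := π.comp (W.toPadicPoint p) with hφ
  have hnd : ¬ p ∣ 2 := fun h ↦ hp2 ((Nat.prime_dvd_prime_iff_eq hp.out Nat.prime_two).mp h)
  -- the rational point of order `2` and its image `g`, an element of order `2` of `G`
  obtain ⟨y, hn, hT⟩ := exists_point_two_nsmul_eq_zero_of_hasRationalTwoTorsionX W hx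
  set T : W.toAffine.Point := Affine.Point.some x y hn with hTdef
  have hT0 : T ≠ 0 := Affine.Point.some_ne_zero hn
  set g := φ T with hg
  have hg0 : g ≠ 0 := by
    intro h0
    have hmem : W.toPadicPoint p T ∈ F1 := by
      rw [hg, hφ, AddMonoidHom.comp_apply, hπ, QuotientAddGroup.mk'_apply,
        QuotientAddGroup.eq_zero_iff] at h0
      exact h0
    have hker : (W.baseChange ℚ_[p]).IsInReductionKernel (W.toPadicPoint p T) := hmem.1
    have h2' : (2 : ℕ) • W.toPadicPoint p T = 0 := by rw [← map_nsmul, hT, map_zero]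
    have h0' := (W.baseChange ℚ_[p]).eq_zero_of_nsmul_eq_zero_of_isInReductionKernel hnd hker h2'
    have hinj : Function.Injective (W.toPadicPoint p) :=
      Affine.Point.map_injective (W' := W.toAffine) (f := Algebra.ofId ℚ ℚ_[p])
    exact hT0 (hinj (by rw [map_zero]; exact h0'))
  have h2g : (2 : ℕ) • g = 0 := by rw [hg, ← map_nsmul, hT, map_zero]
  have hord : addOrderOf g = 2 := addOrderOf_eq_prime h2g hg0
  have h2G : 2 ∣ Nat.card G := hord ▸ addOrderOf_dvd_natCard g
  rw [hcardG] at h2G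
  exact (Nat.coprime_two_left.mpr (hp.out.odd_of_ne_two hp2)).dvd_of_dvd_mul_right h2G

/-- **Kodaira type `III`, `III*` or `Iₙ*` at an odd additive prime of a curve with a rational point of order `2`**
(at the place `v` of `𝓞 ℚ` above `p`): `c_v` is even (`two_dvd_localTamagawaNumber_padic_of_additive_of_hasRationalTwoTorsionX`),
while Tate's algorithm gives odd `c` for the remaining additive types — `II`, `II*`: `c = 1`; `IV`, `IV*`: `c ∈ {1, 3}`
(*ATAEC* IV.9.4 Steps 3, 5, 8, 10; tree facts `localTamagawaNumber_…_holds`).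
[cite: SilvermanATAEC1994, IV.9.4 Steps 3–10 and Table 4.1 (PDF pp. 343–346)] -/
theorem kodairaSymbolAt_of_additive_of_hasRationalTwoTorsionX (hp2 : p ≠ 2)
    (hng : ¬ W.HasGoodReductionAtPrime p) (hnm : ¬ W.HasMultiplicativeReductionAtPrime p)
    {x : ℚ} (hx : HasRationalTwoTorsionX W x) :
    W.kodairaSymbolAt ((primesEquiv (R := 𝓞 ℚ)).symm ⟨p, hp.out⟩) = .III ∨
      W.kodairaSymbolAt ((primesEquiv (R := 𝓞 ℚ)).symm ⟨p, hp.out⟩) = .IIIstar ∨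
      ∃ n : ℕ, W.kodairaSymbolAt ((primesEquiv (R := 𝓞 ℚ)).symm ⟨p, hp.out⟩) = .Istar n := by
  set v : HeightOneSpectrum (𝓞 ℚ) := (primesEquiv (R := 𝓞 ℚ)).symm ⟨p, hp.out⟩ with hvdef
  have hv : primesEquiv v = ⟨p, hp.out⟩ := Equiv.apply_symm_apply _ _
  have hc2 : 2 ∣ (W.baseChange (v.adicCompletion ℚ)).localTamagawaNumber (v.adicCompletionIntegers ℚ) := by
    rw [← localTamagawaNumber_padic_eq_holds W v p (congrArg Subtype.val hv)]
    exact two_dvd_localTamagawaNumber_padic_of_additive_of_hasRationalTwoTorsionX W p hp2 hng hnm hx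
  have hadd : W.HasAdditiveReductionAt v := hasAdditiveReductionAt_ringOfIntegers_of_additive W p hng hnm
  have hA : (W.kodairaSymbolAt v).IsAdditive := (W.isAdditive_kodairaSymbolAt_iff_holds v).mpr hadd
  rcases hK : W.kodairaSymbolAt v with n | _ | _ | _ | n | _ | _ | _
  · -- `Iₙ`: good or multiplicative, not additive
    exfalso
    rw [hK] at hA
    rcases n with _ | n
    · exact hA.1 rfl
    · exact hA.2 ⟨n + 1, n.succ_ne_zero, rfl⟩
  · exfalso
    have h := localTamagawaNumber_eq_one_of_kodairaSymbolAt_eq_II_holds v W hK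
    omega
  · exact Or.inl rfl
  · exfalso
    have h := localTamagawaNumber_of_kodairaSymbolAt_eq_IV_holds v W hK
    omega
  · exact Or.inr (Or.inr ⟨n, rfl⟩)
  · exfalso
    have h := localTamagawaNumber_of_kodairaSymbolAt_eq_IVstar_holds v W hK
    omega
  · exact Or.inr (Or.inl rfl)
  · exfalso
    have h := localTamagawaNumber_eq_one_of_kodairaSymbolAt_eq_IIstar_holds v W hK
    omega

/-- **`f_p = 2` at an odd additive prime of a curve with a rational point of order `2`**, at the place of `ℤ` above
`p`: the types `III`, `III*`, `Iₙ*` at a place `v ∤ 2` have `ord_v(Δ_min) = m_v + 1`, so Ogg's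
`f_v = ord_v(Δ_min) + 1 − m_v = 2` (tree `conductorExponent_eq_two_of_kodairaSymbolAt`).
[cite: SilvermanATAEC1994, Table 4.1 and Thm. IV.11.1 (PDF pp. 367–368)] -/
theorem conductorExponent_eq_two_of_additive_of_hasRationalTwoTorsionX (hp2 : p ≠ 2)
    (hng : ¬ W.HasGoodReductionAtPrime p) (hnm : ¬ W.HasMultiplicativeReductionAtPrime p)
    {x : ℚ} (hx : HasRationalTwoTorsionX W x) :
    W.conductorExponent ((primesEquiv (R := ℤ)).symm ⟨p, hp.out⟩) = 2 := by
  set v : HeightOneSpectrum ℤ := (primesEquiv (R := ℤ)).symm ⟨p, hp.out⟩ with hvdef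
  set v' : HeightOneSpectrum (𝓞 ℚ) := (primesEquiv (R := 𝓞 ℚ)).symm ⟨p, hp.out⟩ with hv'def
  have hv : primesEquiv v = ⟨p, hp.out⟩ := Equiv.apply_symm_apply _ _
  have hv' : primesEquiv v' = ⟨p, hp.out⟩ := Equiv.apply_symm_apply _ _
  have hK' := kodairaSymbolAt_of_additive_of_hasRationalTwoTorsionX W p hp2 hng hnm hx
  -- the Kodaira symbols at the places of `ℤ` and of `𝓞 ℚ` above `p` agree (both are that of `W ⊗ ℚ_p` over `ℤ_p`)
  have hKK : W.kodairaSymbolAt v = W.kodairaSymbolAt v' := by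
    rw [W.kodairaSymbolAt_eq_padic v, W.kodairaSymbolAt_eq_padic v', hv, hv']
  have hgen : natGenerator v = p := congrArg Subtype.val hv
  have h2 : ringChar (ℤ ⧸ v.asIdeal) ≠ 2 := by
    rw [Rat.ringChar_int_quotient_asIdeal, hgen]; exact hp2
  refine W.conductorExponent_eq_two_of_kodairaSymbolAt v h2 ?_
  rw [hKK]
  exact hK'

/-- **`ord_p(N_E) = 2` at an odd additive prime of a curve with a rational point of order `2`.**
[cite: SilvermanATAEC1994, Table 4.1 and Thm. IV.11.1] -/
theorem factorization_conductorNorm_eq_two_of_additive_of_hasRationalTwoTorsionX (hp2 : p ≠ 2)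
    (hng : ¬ W.HasGoodReductionAtPrime p) (hnm : ¬ W.HasMultiplicativeReductionAtPrime p)
    {x : ℚ} (hx : HasRationalTwoTorsionX W x) :
    (W.conductorNorm ℤ).factorization p = 2 := by
  have h := factorization_conductorNorm_primesEquiv_symm W ⟨p, hp.out⟩
  rw [conductorExponent_eq_two_of_additive_of_hasRationalTwoTorsionX W p hp2 hng hnm hx] at h
  exact h

/-- **`ord_p(N_E) ≤ 2` at every odd prime of a curve with a rational point of order `2`** (no hypothesis on the
reduction type; in words: `ℚ(E[2])` has degree `≤ 2`, so the conductor is tame away from `2`).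
[cite: SilvermanATAEC1994, Thm. IV.10.2 and Thm. IV.11.1] -/
theorem factorization_conductorNorm_le_two_of_ne_two_of_hasRationalTwoTorsionX (hp2 : p ≠ 2)
    {x : ℚ} (hx : HasRationalTwoTorsionX W x) :
    (W.conductorNorm ℤ).factorization p ≤ 2 := by
  by_cases hlt : (W.conductorNorm ℤ).factorization p < 2
  · exact hlt.le
  · push Not at hlt
    set v : HeightOneSpectrum ℤ := (primesEquiv (R := ℤ)).symm ⟨p, hp.out⟩ with hvdef
    set v' : HeightOneSpectrum (𝓞 ℚ) := (primesEquiv (R := 𝓞 ℚ)).symm ⟨p, hp.out⟩ with hv'def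
    have hv : primesEquiv v = ⟨p, hp.out⟩ := Equiv.apply_symm_apply _ _
    have hv' : primesEquiv v' = ⟨p, hp.out⟩ := Equiv.apply_symm_apply _ _
    have hf : (W.conductorNorm ℤ).factorization p = W.conductorExponent v :=
      factorization_conductorNorm_primesEquiv_symm W ⟨p, hp.out⟩
    have hff' : W.conductorExponent v = W.conductorExponent v' :=
      conductorExponent_eq_of_primesEquiv_eq v v' W (by rw [hv, hv'])
    have hadd' : W.HasAdditiveReductionAt v' :=
      (two_le_conductorExponent_iff_holds v' W).mp (by rw [← hff', ← hf]; exact hlt)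
    obtain ⟨hng, hnm⟩ := not_good_not_mult_of_hasAdditiveReductionAt_ringOfIntegers W p hadd'
    exact (factorization_conductorNorm_eq_two_of_additive_of_hasRationalTwoTorsionX W p hp2 hng hnm hx).le

/-- **The odd part of the conductor of a curve with a rational point of order `2` is cube-free**: for every odd
prime `p`, `¬ p³ ∣ N_E`. [cite: SilvermanATAEC1994, Thm. IV.10.2 and Thm. IV.11.1] -/
theorem not_pow_three_dvd_conductorNorm_of_hasRationalTwoTorsionX (hp2 : p ≠ 2)
    {x : ℚ} (hx : HasRationalTwoTorsionX W x) : ¬ p ^ 3 ∣ W.conductorNorm ℤ := by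
  intro h
  have hN0 : W.conductorNorm ℤ ≠ 0 := (W.conductorNorm_pos_holds).ne'
  have h3 : 3 ≤ (W.conductorNorm ℤ).factorization p :=
    (hp.out.pow_dvd_iff_le_factorization hN0).mp h
  have h2 := factorization_conductorNorm_le_two_of_ne_two_of_hasRationalTwoTorsionX W p hp2 hx
  omega

end OnePoint

end Literature.NumberTheory.EllipticCurves

end
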